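import Summits.QuantumFields.BalabanUV.T4Continuum.Support.ColourCovariantLaplacian
import Summits.QuantumFields.BalabanUV.T4Continuum.Support.NE2FromNE3

/-!
# T⁴ programme, spine node NE2 (U1a) — THE PRINTED REGULARITY CLASS AS A HYPOTHESIS STRUCTURE ON TRANSPORTER DATA, and the
# covariant-Laplacian summand of Bałaban's `Δ_a(U)` fed by it and by node NE3 BY NAME (tier B, row B5 of `t4/SKELETON-NE2-P1.md`)

NE2 formalisation swarm, leaf prover 03, on top of the row owner's `Support/ColourCovariantLaplacian` and `Support/NE2FromNE3`.
WHAT THE PAPER PRINTS (read by this seat on the rendered journal page; quoted as DOCUMENTATION of what is being typed — no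
declaration below carries it as a cited fact, per the referee's condition c3 of `t4/T4-NE2-TRIGGER.json`).  T. Bałaban, *Propagators for
lattice gauge theories in a background field*, Commun. Math. Phys. **99** (1985) 389–434, p. 396: «For a given positive number α₀ we
consider the class of gauge field configurations U defined on T and satisfying the following regularity conditions: for an arbitrary
cube □ of the described above class, and for a configuration U there exists a gauge transformation u on □ such that Uᵘ = e^{iηA}, and
if the index of □ is j, then |A| < O(1)Mα₀(Lʲη)⁻¹, |∇^η A| < O(1)Mα₀(Lʲη)⁻² on □, where O(1)M is a size of □ in T_{L⁻ʲ}; (3.35)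
|∂^{η*}∂^η A| < O(1)Mα₀(Lʲη)⁻³ on □. (3.36)»; p. 396: «For the operators introduced until now we need only the condition (3.35), but
later on we will have to assume (3.36) also.»

WHAT IS TYPED HERE (GLOBAL small field = one cube of index `j = k`, `Lʲη = 1`; lattice units `L^k = η⁻¹`; transporters
`R^{(k)}_ν(x) ∈ M_o(ℂ)` as DATA, e.g. the adjoint representation of `U_k(x, x + ηe_ν)`; for `U = e^{iηA}` the printed `|A| ≤ α₁`,
`|∇^ηA| ≤ α₁` read `‖L^k(R − 1)‖ ≲ α`, `‖L^k(R(x + e_μ) − R(x))‖ ≲ α/L^k`):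
 * §1 **`RegularTransporters L M R α β`** — a HYPOTHESIS STRUCTURE on data (like the tree's `LipschitzBackgroundM`; no `def … : Prop`
   fact, nothing asserted): SIZE `‖L^k·(R^{(k)}_ν(x) − 1)‖ ≤ α` and LATTICE-LIPSCHITZ `‖L^k·(R^{(k)}_ν(x + e_μ) − R^{(k)}_ν(x))‖ ≤ β/L^k`
   at every level, direction and site — the (3.35)-shape bounds only; the coefficient towers of `Support/ColourCovariantLaplacian` read
   off `R`: connection `connTower = w = L^k(R − 1)` (`= connM`), lattice derivative `dconnTower = L^k(w − w∘τ_ν⁻¹)`, zeroth-order field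
   `zTower = zfieldC`; consequences `‖w‖ ≤ α`, `‖w(x + e_μ) − w(x)‖ ≤ β/L^k`, `‖L^k(w − w∘τ⁻¹)‖ ≤ β`, **`‖z‖ ≤ d(α² + 2β)`**.
 * §2 block-parent geometry at SHIFTED sites: `par(x′ − e_μ) ∈ {par x′, par x′ − e_μ}` (from the tree's `par_add_unitVec`), whence a
   lattice-Lipschitz tower differs by at most `β/L^k` between `parT(τ⁻¹x′)` and `τ⁻¹(parT x′)` (`norm_sub_parT_tauInv_le`).
 * §3 **WHAT ROW B5 OWES THE ASSEMBLY**: given the structure AND the two-level consistencies of the connection tower (`βc`) and of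
   its derivative tower (`βD`) — NOT regularity but an η-RATE of the background tower at adjacent spacings, i.e. node NE3's currency
   (row B6, `Support/NE2FromNE3`) — the matrix-level hypotheses of `Support/ColourCovariantLaplacian` HOLD:
   **`lipschitzBackgroundM_of_regular`** (`−w` is a `LipschitzBackgroundM α (max β βc)`) and **`boundedBackgroundM_of_regular`** (`z` is a
   `BoundedBackgroundM (d(α² + 2β)) (d(2α(βc + β) + 2βD))`; the consistency of `z = Σ_ν[(w_νᴴw_ν)∘τ_ν⁻¹ − D_νw_ν − (D_νw_ν)ᴴ]` uses §2
   and CONSUMES the derivative tower's consistency — second-order information, where (3.36) enters Bałaban's text; named, not hidden).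
 * §4 THE DAG EDGE FOR THIS SUMMAND: with the class `regClass R = {connTower R, dconnTower R}`, NE3's predicate
   `T4EtaRateMin.LocalRate (NE2FromNE3.bgReadings (regClass R)) C L⁻¹` supplies `βc = βD = 2·card o·C` (`consistent_of_localRate_lev`),
   hence **`perturbationLaws_covariantLaplacian_of_regular`**: the typed residual `BackgroundResolventTower.PerturbationLaws` for the
   summand `P_k = Δ^{R_k} − Δ^1 ⊗ 1` of `Δ_a(U_k) − Δ_a(1) ⊗ 1` against the lifted free tower and King's pairing, from
   `(hreg : RegularTransporters R α β)` and `(hNE3 : LocalRate …)` DISPLAYED AS BINDERS, `κ` explicit; and at the physical coupling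
   `t = 1`, small-field regime `κ < 1`, the η-RATE **`covariantLaplacian_rate_of_regular`** (`TowerLimitRate`, rate `L⁻¹`) — by the
   owner's `perturbationLaws_colourCovariantLaplacian` / `colourCovariantLaplacian_rate_of_matrixBounds`, imported BY NAME.

HONEST FRAMING (T4-DAG p. 1).  Bookkeeping over finite matrices; MODEL LEVEL (transporters are data, no group structure, GLOBAL small
field — no cubes of several indices, no regions Ω_j, no Dirichlet holes); ONLY the covariant-Laplacian summand of [B9] (3.26)
`Δ_a = Δ + DRD* + Q*aQ` (rows B3/B4/B7 are other seats' rows); the dictionary B0 is NOT asserted; the existence of a regular gauge for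
Bałaban's minimisers ([B8] CMP 99 75–102) is NOT used or asserted — it is where a consumer would get `hreg` from; `hNE3` is node NE3's
own tree predicate (OPEN) consumed BY NAME, no `Prop` mirror; finite torus, linear layer, operator norm; constants OURS; NE2 NOT proved;
NOT infinite volume, NOT a mass gap, NOT Clay, NOT summit progress; spine 0/9 unchanged.  HONEST DEPENDENCY: continuum YM on T⁴ ⇐
BetaPertH ∧ nine spine estimates (0/9 proved); BetaPertH ⇐ (D1) ∧ (D4) ∧ CAP+tail; G-an2-4 gates asym, D1 and NE2/3/4.  ABSOLUTE RULE
kept (nothing internally minted enters as a cited fact); no `sorry`.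
-/

noncomputable section

open scoped BigOperators ComplexConjugate Matrix Matrix.Norms.L2Operator Kronecker

namespace Summit.QuantumFields.BalabanUV.T4Continuum.RegularBackgroundTower

open Literature.MathematicalPhysics.QuantumFieldTheory.Balaban1983to89.B5Prop11Plancherel
open Literature.MathematicalPhysics.QuantumFieldTheory.Balaban1983to89.B5G183RateUnitTower (lev lev_neZero)
open Literature.MathematicalPhysics.QuantumFieldTheory.Balaban1983to89.T4EtaRateMin (LocalRate)
open Summit.QuantumFields.BalabanUV.T4Continuum
open Summit.QuantumFields.BalabanUV.T4Continuum.CovariantAveragingTower (TowerLimitRate)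
open Summit.QuantumFields.BalabanUV.T4Continuum.BalabanAveragedTowerModes (par)
open Summit.QuantumFields.BalabanUV.T4Continuum.BalabanAveragedTowerUnit (idx Qlev one_le_lev' cast_lev')
open Summit.QuantumFields.BalabanUV.T4Continuum.BackgroundResolventTower
open Summit.QuantumFields.BalabanUV.T4Continuum.KingPairingPlantedLaw
open Summit.QuantumFields.BalabanUV.T4Continuum.BlockPairingGeometry
open Summit.QuantumFields.BalabanUV.T4Continuum.NE2PerturbedLayer
open Summit.QuantumFields.BalabanUV.T4Continuum.AbelianCovariantLaplacian (tauInv tauInv_tau tau_tauInv star_natCast_complex)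
open Summit.QuantumFields.BalabanUV.T4Continuum.ColourCovariantLaplacian
open Summit.QuantumFields.BalabanUV.T4Continuum.NE2FromNE3 (bgReadings consistent_of_localRate_lev)

variable {d : ℕ} {o : Type*} [DecidableEq o]

/-! ## §1 The regularity class (3.35) as a hypothesis structure on transporter data, and its coefficient towers -/

section Towers
variable (L : ℕ) (M : Fin d → ℕ)

/-- the connection tower `w^{(k)}_ν = L^k(R^{(k)}_ν − 1)` (`= ColourCovariantLaplacian.connM` level by level). [folklore] -/
def connTower (R : (k : ℕ) → Fin d → (idx L M k → Matrix o o ℂ)) (k : ℕ) (ν : Fin d) (i : idx L M k) : Matrix o o ℂ :=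
  connM (fine (lev L k) M) ((lev L k : ℕ) : ℂ) (R k) ν i

/-- the lattice derivative tower `D_νw^{(k)}_ν = L^k(w^{(k)}_ν − w^{(k)}_ν∘τ_ν⁻¹)` (backward difference in the field's own direction —
the combination entering `zfieldC`). [folklore] -/
def dconnTower (R : (k : ℕ) → Fin d → (idx L M k → Matrix o o ℂ)) (k : ℕ) (ν : Fin d) (i : idx L M k) : Matrix o o ℂ :=
  ((lev L k : ℕ) : ℂ) • (connTower L M R k ν i - connTower L M R k ν (tauInv (fine (lev L k) M) ν i))

/-- the two-element class of coefficient towers read by node NE3 for this summand: the connection and its lattice derivative. [folklore] -/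
def regClass (R : (k : ℕ) → Fin d → (idx L M k → Matrix o o ℂ)) : Set ((k : ℕ) → Fin d → (idx L M k → Matrix o o ℂ)) :=
  {connTower L M R, dconnTower L M R}

variable {L M}

/-- `w = L^k(R − 1)`. [folklore] -/
theorem connTower_eq (R : (k : ℕ) → Fin d → (idx L M k → Matrix o o ℂ)) (k : ℕ) (ν : Fin d) (i : idx L M k) :
    connTower L M R k ν i = ((lev L k : ℕ) : ℂ) • (R k ν i - 1) := rfl

/-- `negConnM = −w` level by level. [folklore] -/
theorem negConnM_eq_neg (R : (k : ℕ) → Fin d → (idx L M k → Matrix o o ℂ)) (k : ℕ) (ν : Fin d) (i : idx L M k) :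
    negConnM (fine (lev L k) M) ((lev L k : ℕ) : ℂ) (R k) ν i = -connTower L M R k ν i := rfl

/-- `w(x + e_μ) − w(x) = L^k(R(x + e_μ) − R(x))`. [folklore] -/
theorem connTower_tau_sub (R : (k : ℕ) → Fin d → (idx L M k → Matrix o o ℂ)) (k : ℕ) (ν μ : Fin d) (i : idx L M k) :
    connTower L M R k ν (tau (fine (lev L k) M) μ i) - connTower L M R k ν i
      = ((lev L k : ℕ) : ℂ) • (R k ν (tau (fine (lev L k) M) μ i) - R k ν i) := by
  rw [connTower_eq, connTower_eq, ← smul_sub, sub_sub_sub_cancel_right]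

end Towers

variable [Fintype o]

section Structure
variable (L : ℕ) (M : Fin d → ℕ)

/-- **THE PRINTED REGULARITY CLASS, (3.35)-SHAPE, GLOBAL SMALL FIELD, ON TRANSPORTER DATA**: at every level `k` (lattice units
`L^k = η⁻¹`), every direction `ν` and site `x`, SIZE `‖L^k·(R^{(k)}_ν(x) − 1)‖ ≤ α` (the printed `|A| < α₁(Lʲη)⁻¹` for `U = e^{iηA}`)
and LATTICE-LIPSCHITZ `‖L^k·(R^{(k)}_ν(x + e_μ) − R^{(k)}_ν(x))‖ ≤ β/L^k` (the printed `|∇^ηA| < α₁(Lʲη)⁻²`).  A hypothesis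
structure on data; nothing is asserted about Bałaban's minimisers. [folklore] -/
structure RegularTransporters (R : (k : ℕ) → Fin d → (idx L M k → Matrix o o ℂ)) (α β : ℝ) : Prop where
  /-- `α, β ≥ 0` -/
  nonneg : 0 ≤ α ∧ 0 ≤ β
  /-- size of the connection in lattice units -/
  size : ∀ k ν (i : idx L M k), ‖((lev L k : ℕ) : ℂ) • (R k ν i - 1)‖ ≤ α
  /-- lattice-Lipschitz bound of the transporters -/
  lipschitz : ∀ k ν μ (i : idx L M k),
    ‖((lev L k : ℕ) : ℂ) • (R k ν (tau (fine (lev L k) M) μ i) - R k ν i)‖ ≤ β / (lev L k : ℕ)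

/-- the zeroth-order tower `z^{(k)} = zfieldC` of `Support/ColourCovariantLaplacian`. [folklore] -/
def zTower (R : (k : ℕ) → Fin d → (idx L M k → Matrix o o ℂ)) (k : ℕ) (i : idx L M k) : Matrix o o ℂ :=
  zfieldC (fine (lev L k) M) ((lev L k : ℕ) : ℂ) (R k) i

variable {L M} {R : (k : ℕ) → Fin d → (idx L M k → Matrix o o ℂ)} {α β : ℝ}

/-- `z` in terms of the towers: `z(x) = Σ_ν [w_ν(x − e_ν)ᴴw_ν(x − e_ν) − D_νw_ν(x) − (D_νw_ν(x))ᴴ]`. [folklore] -/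
theorem zTower_eq (R : (k : ℕ) → Fin d → (idx L M k → Matrix o o ℂ)) (k : ℕ) (i : idx L M k) :
    zTower L M R k i = ∑ ν, ((connTower L M R k ν (tauInv (fine (lev L k) M) ν i))ᴴ * connTower L M R k ν (tauInv (fine (lev L k) M) ν i)
      - dconnTower L M R k ν i - (dconnTower L M R k ν i)ᴴ) := by
  unfold zTower zfieldC dconnTower connTower
  refine Finset.sum_congr rfl fun ν _ => ?_
  rw [Matrix.conjTranspose_smul, star_natCast_complex]

/-- SIZE: `‖w‖ ≤ α`. [folklore] -/
theorem norm_connTower_le (h : RegularTransporters L M R α β) (k : ℕ) (ν : Fin d) (i : idx L M k) :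
    ‖connTower L M R k ν i‖ ≤ α := h.size k ν i

/-- LIPSCHITZ: `‖w(x + e_μ) − w(x)‖ ≤ β/L^k`. [folklore] -/
theorem connTower_lipschitz (h : RegularTransporters L M R α β) (k : ℕ) (ν μ : Fin d) (i : idx L M k) :
    ‖connTower L M R k ν (tau (fine (lev L k) M) μ i) - connTower L M R k ν i‖ ≤ β / (lev L k : ℕ) := by
  rw [connTower_tau_sub]; exact h.lipschitz k ν μ i

/-- the same at a backward-shifted site: `‖w(x) − w(x − e_μ)‖ ≤ β/L^k`. [folklore] -/
theorem connTower_lipschitz_tauInv (h : RegularTransporters L M R α β) (k : ℕ) (ν μ : Fin d) (i : idx L M k) :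
    ‖connTower L M R k ν i - connTower L M R k ν (tauInv (fine (lev L k) M) μ i)‖ ≤ β / (lev L k : ℕ) := by
  have h1 := connTower_lipschitz h k ν μ (tauInv (fine (lev L k) M) μ i)
  rwa [tau_tauInv] at h1

/-- `‖XᴴX − YᴴY‖ ≤ (‖X‖ + ‖Y‖)·‖X − Y‖` in the `ℓ²`-operator norm. [folklore] -/
theorem norm_gram_sub_gram_le (X Y : Matrix o o ℂ) : ‖Xᴴ * X - Yᴴ * Y‖ ≤ (‖X‖ + ‖Y‖) * ‖X - Y‖ := by
  have e : Xᴴ * X - Yᴴ * Y = Xᴴ * (X - Y) + (X - Y)ᴴ * Y := by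
    rw [Matrix.conjTranspose_sub, Matrix.mul_sub, Matrix.sub_mul]; abel
  rw [e]
  calc ‖Xᴴ * (X - Y) + (X - Y)ᴴ * Y‖ ≤ ‖Xᴴ * (X - Y)‖ + ‖(X - Y)ᴴ * Y‖ := norm_add_le _ _
    _ ≤ ‖Xᴴ‖ * ‖X - Y‖ + ‖(X - Y)ᴴ‖ * ‖Y‖ := add_le_add (norm_mul_le _ _) (norm_mul_le _ _)
    _ = (‖X‖ + ‖Y‖) * ‖X - Y‖ := by rw [Matrix.l2_opNorm_conjTranspose, Matrix.l2_opNorm_conjTranspose]; ring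

variable [NeZero L]

/-- the level factor is positive. [folklore] -/
theorem lev_pos (L : ℕ) [NeZero L] (k : ℕ) : (0 : ℝ) < (lev L k : ℕ) := by exact_mod_cast one_le_lev' L k

/-- DERIVATIVE SIZE: `‖L^k(w − w∘τ⁻¹)‖ ≤ β`. [folklore] -/
theorem norm_dconnTower_le (h : RegularTransporters L M R α β) (k : ℕ) (ν : Fin d) (i : idx L M k) :
    ‖dconnTower L M R k ν i‖ ≤ β := by
  have hlev := lev_pos L k
  rw [dconnTower, norm_smul, Complex.norm_natCast]
  calc ((lev L k : ℕ) : ℝ) * ‖connTower L M R k ν i - connTower L M R k ν (tauInv (fine (lev L k) M) ν i)‖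
      ≤ ((lev L k : ℕ) : ℝ) * (β / (lev L k : ℕ)) := mul_le_mul_of_nonneg_left (connTower_lipschitz_tauInv h k ν ν i) hlev.le
    _ = β := by field_simp

/-- **ZEROTH-ORDER SIZE: `‖z‖ ≤ d(α² + 2β)`**. [folklore] -/
theorem norm_zTower_le (h : RegularTransporters L M R α β) (k : ℕ) (i : idx L M k) :
    ‖zTower L M R k i‖ ≤ d * (α ^ 2 + 2 * β) := by
  rw [zTower_eq]
  have hα := h.nonneg.1
  calc ‖∑ ν, ((connTower L M R k ν (tauInv (fine (lev L k) M) ν i))ᴴ * connTower L M R k ν (tauInv (fine (lev L k) M) ν i)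
          - dconnTower L M R k ν i - (dconnTower L M R k ν i)ᴴ)‖
      ≤ ∑ ν : Fin d, (α ^ 2 + 2 * β) := by
        refine norm_sum_le_of_le _ fun ν _ => ?_
        set X := connTower L M R k ν (tauInv (fine (lev L k) M) ν i)
        set D := dconnTower L M R k ν i
        have hX : ‖X‖ ≤ α := norm_connTower_le h k ν _
        have hD : ‖D‖ ≤ β := norm_dconnTower_le h k ν i
        calc ‖Xᴴ * X - D - Dᴴ‖ ≤ ‖Xᴴ * X - D‖ + ‖Dᴴ‖ := norm_sub_le _ _
          _ ≤ ‖Xᴴ * X‖ + ‖D‖ + ‖Dᴴ‖ := add_le_add (norm_sub_le _ _) le_rfl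
          _ ≤ α * α + β + β := by
            have hG : ‖Xᴴ * X‖ ≤ α * α :=
              (norm_mul_le _ _).trans (by rw [Matrix.l2_opNorm_conjTranspose]; exact mul_le_mul hX hX (norm_nonneg _) hα)
            rw [Matrix.l2_opNorm_conjTranspose]; exact add_le_add (add_le_add hG hD) hD
          _ = α ^ 2 + 2 * β := by ring
    _ = d * (α ^ 2 + 2 * β) := by rw [Finset.sum_const, Finset.card_univ, Fintype.card_fin, nsmul_eq_mul]

end Structure

/-! ## §2 Block-parent geometry at backward-shifted sites -/

section Geometry
variable (N R : ℕ) [NeZero N] [NeZero R] (M : Fin d → ℕ) [hM : ∀ μ, NeZero (M μ)]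

/-- **THE PARENT OF A BACKWARD-SHIFTED SITE**: `par(x′ − e_μ) = par x′` or `par(x′ − e_μ) = par x′ − e_μ` (torus wrap-around in both
lattices included). [cite: King1986, (2.10) p.653 (block pairing, shape)] [folklore] -/
theorem par_sub_unitVec_cases (μ : Fin d) (x : Tor (fine (R * N) M)) :
    par N R M (x - unitVec (fine (R * N) M) μ) = par N R M x ∨
    par N R M (x - unitVec (fine (R * N) M) μ) = par N R M x - unitVec (fine N M) μ := by
  have key := par_add_unitVec N R M μ (x - unitVec (fine (R * N) M) μ)
  rw [sub_add_cancel] at key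
  by_cases hf : R ∣ ((x - unitVec (fine (R * N) M) μ) μ).val + 1
  · rw [if_pos hf] at key; exact Or.inr (eq_sub_of_add_eq key.symm)
  · rw [if_neg hf] at key; exact Or.inl key.symm

/-- the same on indices: `parT(τ_μ⁻¹ x′) = parT x′` or `parT(τ_μ⁻¹ x′) = τ_μ⁻¹(parT x′)`. [folklore] -/
theorem parT_tauInv_cases (μ : Fin d) (i : Tor (fine (R * N) M) × Fin d) :
    parT N R M (tauInv (fine (R * N) M) μ i) = parT N R M i ∨
    parT N R M (tauInv (fine (R * N) M) μ i) = tauInv (fine N M) μ (parT N R M i) := by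
  rcases par_sub_unitVec_cases N R M μ i.1 with h | h
  · exact Or.inl (Prod.ext h rfl)
  · exact Or.inr (Prod.ext h rfl)

end Geometry

section TwoLevel
variable {L : ℕ} [NeZero L] {M : Fin d → ℕ} [hM : ∀ μ, NeZero (M μ)]

/-- the dichotomy along the tower (`n_{k+1} = L·n_k`): `parT(τ_ν⁻¹x′) = parT x′` or `= τ_ν⁻¹(parT x′)`. [folklore] -/
theorem parT_tauInv_cases_lev (k : ℕ) (ν : Fin d) (i : idx L M (k + 1)) :
    parT (lev L k) L M (tauInv (fine (lev L (k + 1)) M) ν i) = parT (lev L k) L M i ∨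
    parT (lev L k) L M (tauInv (fine (lev L (k + 1)) M) ν i) = tauInv (fine (lev L k) M) ν (parT (lev L k) L M i) :=
  parT_tauInv_cases (lev L k) L M ν i

/-- a lattice-Lipschitz tower differs by at most `β/L^k` between `parT(τ_ν⁻¹x′)` and `τ_ν⁻¹(parT x′)`. [folklore] -/
theorem norm_sub_parT_tauInv_le {W : (k : ℕ) → Fin d → (idx L M k → Matrix o o ℂ)} {β : ℝ} (hβ : 0 ≤ β)
    (hlip : ∀ k μ ν (i : idx L M k), ‖W k μ (tau (fine (lev L k) M) ν i) - W k μ i‖ ≤ β / (lev L k : ℕ))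
    (k : ℕ) (μ ν : Fin d) (i : idx L M (k + 1)) :
    ‖W k μ (parT (lev L k) L M (tauInv (fine (lev L (k + 1)) M) ν i)) - W k μ (tauInv (fine (lev L k) M) ν (parT (lev L k) L M i))‖
      ≤ β / (lev L k : ℕ) := by
  rcases parT_tauInv_cases_lev k ν i with h | h
  · rw [h]
    have h1 := hlip k μ ν (tauInv (fine (lev L k) M) ν (parT (lev L k) L M i))
    rwa [tau_tauInv] at h1
  · rw [h, sub_self, norm_zero]; exact div_nonneg hβ (Nat.cast_nonneg _)

/-- consistency read at a backward-shifted site: `‖W′(τ⁻¹x′) − W(τ⁻¹(parT x′))‖ ≤ (βc + β)/L^k`. [folklore] -/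
theorem norm_tauInv_sub_tauInv_parT_le {W : (k : ℕ) → Fin d → (idx L M k → Matrix o o ℂ)} {β βc : ℝ} (hβ : 0 ≤ β)
    (hlip : ∀ k μ ν (i : idx L M k), ‖W k μ (tau (fine (lev L k) M) ν i) - W k μ i‖ ≤ β / (lev L k : ℕ))
    (hcons : ∀ k μ (i : idx L M (k + 1)), ‖W (k + 1) μ i - W k μ (parT (lev L k) L M i)‖ ≤ βc / (lev L k : ℕ))
    (k : ℕ) (μ ν : Fin d) (i : idx L M (k + 1)) :
    ‖W (k + 1) μ (tauInv (fine (lev L (k + 1)) M) ν i) - W k μ (tauInv (fine (lev L k) M) ν (parT (lev L k) L M i))‖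
      ≤ (βc + β) / (lev L k : ℕ) := by
  rw [add_div]
  calc ‖W (k + 1) μ (tauInv (fine (lev L (k + 1)) M) ν i) - W k μ (tauInv (fine (lev L k) M) ν (parT (lev L k) L M i))‖
      ≤ ‖W (k + 1) μ (tauInv (fine (lev L (k + 1)) M) ν i) - W k μ (parT (lev L k) L M (tauInv (fine (lev L (k + 1)) M) ν i))‖
        + ‖W k μ (parT (lev L k) L M (tauInv (fine (lev L (k + 1)) M) ν i)) - W k μ (tauInv (fine (lev L k) M) ν (parT (lev L k) L M i))‖ :=
        norm_sub_le_norm_sub_add_norm_sub _ _ _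
    _ ≤ βc / (lev L k : ℕ) + β / (lev L k : ℕ) := add_le_add (hcons k μ _) (norm_sub_parT_tauInv_le hβ hlip k μ ν i)

end TwoLevel

/-! ## §3 What row B5 owes the assembly: the matrix-level hypotheses of `Support/ColourCovariantLaplacian` -/

section Assembly
variable (L : ℕ) [NeZero L] (M : Fin d → ℕ) [hM : ∀ μ, NeZero (M μ)]
variable {R : (k : ℕ) → Fin d → (idx L M k → Matrix o o ℂ)} {α β βc βD : ℝ}

omit [NeZero L] hM in
/-- **`−w` IS A `LipschitzBackgroundM α (max β βc)`** given the (3.35)-shape structure and the two-level consistency of the connection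
tower (constant `βc` — node NE3's currency, row B6). [folklore] -/
theorem lipschitzBackgroundM_of_regular (hreg : RegularTransporters L M R α β)
    (hcons : ∀ k ν (i : idx L M (k + 1)), ‖connTower L M R (k + 1) ν i - connTower L M R k ν (parT (lev L k) L M i)‖ ≤ βc / (lev L k : ℕ)) :
    LipschitzBackgroundM L M (fun k ν i => negConnM (fine (lev L k) M) ((lev L k : ℕ) : ℂ) (R k) ν i) α (max β βc) where
  nonneg := ⟨hreg.nonneg.1, le_max_of_le_left hreg.nonneg.2⟩
  bound := fun k μ i => by
    show ‖negConnM (fine (lev L k) M) ((lev L k : ℕ) : ℂ) (R k) μ i‖ ≤ α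
    rw [negConnM_eq_neg, norm_neg]; exact norm_connTower_le hreg k μ i
  lipschitz := fun k μ ν i => by
    show ‖negConnM (fine (lev L k) M) ((lev L k : ℕ) : ℂ) (R k) μ (tau (fine (lev L k) M) ν i)
        - negConnM (fine (lev L k) M) ((lev L k : ℕ) : ℂ) (R k) μ i‖ ≤ max β βc / (lev L k : ℕ)
    rw [negConnM_eq_neg, negConnM_eq_neg, neg_sub_neg, norm_sub_rev]
    exact (connTower_lipschitz hreg k μ ν i).trans (div_le_div_of_nonneg_right (le_max_left _ _) (Nat.cast_nonneg _))
  consistent := fun k μ i => by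
    show ‖negConnM (fine (lev L (k + 1)) M) ((lev L (k + 1) : ℕ) : ℂ) (R (k + 1)) μ i
        - negConnM (fine (lev L k) M) ((lev L k : ℕ) : ℂ) (R k) μ (parT (lev L k) L M i)‖ ≤ max β βc / (lev L k : ℕ)
    rw [negConnM_eq_neg, negConnM_eq_neg, neg_sub_neg, norm_sub_rev]
    exact (hcons k μ i).trans (div_le_div_of_nonneg_right (le_max_right _ _) (Nat.cast_nonneg _))

/-- **`z` IS A `BoundedBackgroundM (d(α² + 2β)) (d(2α(βc + β) + 2βD))`** given the (3.35)-shape structure, the two-level consistency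
of the connection tower (`βc`) AND of its derivative tower (`βD`) — both NE3's currency; the shifted arguments are handled by §2.
[folklore] -/
theorem boundedBackgroundM_of_regular (hreg : RegularTransporters L M R α β) (hβc : 0 ≤ βc) (hβD : 0 ≤ βD)
    (hcons : ∀ k ν (i : idx L M (k + 1)), ‖connTower L M R (k + 1) ν i - connTower L M R k ν (parT (lev L k) L M i)‖ ≤ βc / (lev L k : ℕ))
    (hconsD : ∀ k ν (i : idx L M (k + 1)),
      ‖dconnTower L M R (k + 1) ν i - dconnTower L M R k ν (parT (lev L k) L M i)‖ ≤ βD / (lev L k : ℕ)) :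
    BoundedBackgroundM L M (fun k i => zfieldC (fine (lev L k) M) ((lev L k : ℕ) : ℂ) (R k) i)
      (d * (α ^ 2 + 2 * β)) (d * (2 * α * (βc + β) + 2 * βD)) where
  nonneg := by
    obtain ⟨hα, hβ⟩ := hreg.nonneg
    exact ⟨by positivity, by positivity⟩
  bound := fun k i => norm_zTower_le hreg k i
  consistent := fun k i => by
    obtain ⟨hα, hβ⟩ := hreg.nonneg
    have hlev := lev_pos L k
    show ‖zTower L M R (k + 1) i - zTower L M R k (parT (lev L k) L M i)‖ ≤ d * (2 * α * (βc + β) + 2 * βD) / (lev L k : ℕ)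
    rw [zTower_eq, zTower_eq, ← Finset.sum_sub_distrib]
    set p := parT (lev L k) L M i with hp
    calc ‖∑ ν, ((connTower L M R (k + 1) ν (tauInv (fine (lev L (k + 1)) M) ν i))ᴴ
              * connTower L M R (k + 1) ν (tauInv (fine (lev L (k + 1)) M) ν i)
            - dconnTower L M R (k + 1) ν i - (dconnTower L M R (k + 1) ν i)ᴴ
            - ((connTower L M R k ν (tauInv (fine (lev L k) M) ν p))ᴴ * connTower L M R k ν (tauInv (fine (lev L k) M) ν p)
              - dconnTower L M R k ν p - (dconnTower L M R k ν p)ᴴ))‖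
        ≤ ∑ ν : Fin d, (2 * α * (βc + β) + 2 * βD) / (lev L k : ℕ) := by
          refine norm_sum_le_of_le _ fun ν _ => ?_
          set X' := connTower L M R (k + 1) ν (tauInv (fine (lev L (k + 1)) M) ν i)
          set X := connTower L M R k ν (tauInv (fine (lev L k) M) ν p)
          set D' := dconnTower L M R (k + 1) ν i
          set D := dconnTower L M R k ν p
          have hX' : ‖X'‖ ≤ α := norm_connTower_le hreg (k + 1) ν _
          have hX : ‖X‖ ≤ α := norm_connTower_le hreg k ν _
          have hXX : ‖X' - X‖ ≤ (βc + β) / (lev L k : ℕ) :=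
            norm_tauInv_sub_tauInv_parT_le hβ (fun k μ ν i => connTower_lipschitz hreg k μ ν i) (fun k μ i => hcons k μ i) k ν ν i
          have hDD : ‖D' - D‖ ≤ βD / (lev L k : ℕ) := hconsD k ν i
          have e : X'ᴴ * X' - D' - D'ᴴ - (Xᴴ * X - D - Dᴴ) = (X'ᴴ * X' - Xᴴ * X) - (D' - D) - (D' - D)ᴴ := by
            rw [Matrix.conjTranspose_sub]; abel
          rw [e]
          calc ‖(X'ᴴ * X' - Xᴴ * X) - (D' - D) - (D' - D)ᴴ‖
              ≤ ‖X'ᴴ * X' - Xᴴ * X‖ + ‖D' - D‖ + ‖(D' - D)ᴴ‖ :=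
                (norm_sub_le _ _).trans (add_le_add (norm_sub_le _ _) le_rfl)
            _ ≤ (α + α) * ((βc + β) / (lev L k : ℕ)) + βD / (lev L k : ℕ) + βD / (lev L k : ℕ) := by
                rw [Matrix.l2_opNorm_conjTranspose]
                refine add_le_add (add_le_add ?_ hDD) hDD
                exact (norm_gram_sub_gram_le X' X).trans
                  (mul_le_mul (add_le_add hX' hX) hXX (norm_nonneg _) (by positivity))
            _ = (2 * α * (βc + β) + 2 * βD) / (lev L k : ℕ) := by field_simp; ring
      _ = d * (2 * α * (βc + β) + 2 * βD) / (lev L k : ℕ) := by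
          rw [Finset.sum_const, Finset.card_univ, Fintype.card_fin, nsmul_eq_mul, mul_div_assoc]

/-! ## §4 The DAG edge for this summand: NE3's `LocalRate` on the class `{w, Dw}` ⇒ the consistencies ⇒ `PerturbationLaws` -/

/-- the NE3 constant in the `β/L^k` currency: `βNE3 = 2·card o·C`. [folklore] -/
def betaNE3 (o : Type*) [Fintype o] (C : ℝ) : ℝ := 2 * (Fintype.card o : ℝ) * C

/-- **NE3's currency ⇒ the two matrix-level hypotheses of `Support/ColourCovariantLaplacian`**, from `hreg` and `hNE3` (the
consistencies of `w` and `Dw` are READ OFF `LocalRate` by `NE2FromNE3.consistent_of_localRate_lev`, `βc = βD = 2·card o·C`). [folklore] -/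
theorem matrixBounds_of_regular_of_localRate (hreg : RegularTransporters L M R α β) {C : ℝ} (hC : 0 ≤ C)
    (hNE3 : LocalRate (bgReadings L M (regClass L M R)) C ((L : ℝ)⁻¹)) :
    LipschitzBackgroundM L M (fun k ν i => negConnM (fine (lev L k) M) ((lev L k : ℕ) : ℂ) (R k) ν i) α (max β (betaNE3 o C)) ∧
    BoundedBackgroundM L M (fun k i => zfieldC (fine (lev L k) M) ((lev L k : ℕ) : ℂ) (R k) i)
      (d * (α ^ 2 + 2 * β)) (d * (2 * α * (betaNE3 o C + β) + 2 * betaNE3 o C)) := by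
  have hb : 0 ≤ betaNE3 o C := by unfold betaNE3; positivity
  have hw := consistent_of_localRate_lev L M hC hNE3 (Set.mem_insert _ _ : connTower L M R ∈ regClass L M R)
  have hD := consistent_of_localRate_lev L M hC hNE3
    (Set.mem_insert_of_mem _ (Set.mem_singleton _) : dconnTower L M R ∈ regClass L M R)
  exact ⟨lipschitzBackgroundM_of_regular L M hreg hw, boundedBackgroundM_of_regular L M hreg hb hb hw hD⟩

variable (a : ℝ) (ha : 0 < a)

/-- **THE TYPED RESIDUAL FOR THE COVARIANT-LAPLACIAN SUMMAND OF `Δ_a(U) − Δ_a(1)⊗1`, FROM THE REGULARITY CLASS AND NODE NE3 BY NAME**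
(`d ≥ 1`): `PerturbationLaws (Δ_a ⊗ 1) (k ↦ Δ^{R_k} − Δ^1 ⊗ 1) (J ⊗ 1) κ (k ↦ C₂·L^{−k})` with
`κ = kappaCol o d a α (max β βNE3) (d(α² + 2β))`, `C₂ = C2col o d L a α (max β βNE3) (d(2α(βNE3 + β) + 2βNE3))`, `βNE3 = 2·card o·C`.
Both binders `hreg` (the (3.35)-shape class) and `hNE3` (node NE3's `LocalRate` on the class `{w, Dw}`) are DISPLAYED; nothing about
Bałaban's minimisers is asserted. [folklore] -/
theorem perturbationLaws_covariantLaplacian_of_regular (hd : 1 ≤ d) (hreg : RegularTransporters L M R α β) {C : ℝ} (hC : 0 ≤ C)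
    (hNE3 : LocalRate (bgReadings L M (regClass L M R)) C ((L : ℝ)⁻¹)) :
    PerturbationLaws (fun k => calDalev L M a ha k ⊗ₖ (1 : Matrix o o ℂ)) (covPertC L M R)
      (fun k => JpcT L M k ⊗ₖ (1 : Matrix o o ℂ)) (kappaCol o d a α (max β (betaNE3 o C)) (d * (α ^ 2 + 2 * β)))
      (fun k => C2col o d L a α (max β (betaNE3 o C)) (d * (2 * α * (betaNE3 o C + β) + 2 * betaNE3 o C)) * ((L : ℝ)⁻¹) ^ k) := by
  obtain ⟨hV, hz⟩ := matrixBounds_of_regular_of_localRate L M hreg hC hNE3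
  exact perturbationLaws_colourCovariantLaplacian L M a ha hd (fun p => lipschitzBackground_entry L M hV p)
    (fun p => boundedBackground_entry L M hz p)

/-- **THE η-RATE OF THE COVARIANT-LAPLACIAN COUPLING IN THE REGULARITY CLASS, CONDITIONAL ON NE3 BY NAME** (`L ≥ 2`, `d ≥ 1`,
physical coupling `t = 1`, small-field regime `κ < 1` DISPLAYED): the lifted King-averaged unit-lattice covariances of
`(Δ_a^{(k)} ⊗ 1 + Δ^{R_k} − Δ^1 ⊗ 1)⁻¹` converge as `k → ∞` with rate `L^{−k}`.  Binders `hreg`, `hNE3` displayed; NE2 is NOT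
proved by this (one summand of three, model level, conditional on NE3). [folklore] -/
theorem covariantLaplacian_rate_of_regular (hL : 2 ≤ L) (hd : 1 ≤ d) (hreg : RegularTransporters L M R α β) {C : ℝ} (hC : 0 ≤ C)
    (hNE3 : LocalRate (bgReadings L M (regClass L M R)) C ((L : ℝ)⁻¹))
    (hsmall : kappaCol o d a α (max β (betaNE3 o C)) (d * (α ^ 2 + 2 * β)) < 1) :
    TowerLimitRate (fun k => Qlev L M k ⊗ₖ (1 : Matrix o o ℂ)) ((L : ℝ) ^ d)
      (fun k => (calDalev L M a ha k ⊗ₖ (1 : Matrix o o ℂ) + covPertC L M R k)⁻¹)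
      (Cpert (kappaCol o d a α (max β (betaNE3 o C)) (d * (α ^ 2 + 2 * β))) (2 * d * Cst d a) (CJ d a)
        (C2col o d L a α (max β (betaNE3 o C)) (d * (2 * α * (betaNE3 o C + β) + 2 * betaNE3 o C))) 0 1) ((L : ℝ)⁻¹) := by
  obtain ⟨hV, hz⟩ := matrixBounds_of_regular_of_localRate L M hreg hC hNE3
  exact colourCovariantLaplacian_rate_of_matrixBounds L M a ha hL hd hV hz hsmall

end Assembly

end Summit.QuantumFields.BalabanUV.T4Continuum.RegularBackgroundTower

end
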